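import Summits.CriticalPhenomena.SAWScalingLimit.Theses.SAWRestrictionRigidity
import Literature.Probability.RandomPlanarGeometry.RadoContinuity

/-!
# Stub `stub_radoExtensionDisc` of line `registered` (reshape v5, dichotomy + reference-disc cut), crux `Rigidity` (stmt-CriticalPhenomena-1368), route SAWRestrictionRigidity

Target: `Summits/CriticalPhenomena/SAWScalingLimit/Theorems/SAWRestrictionRigidityRigidityRadoExtensionDisc.lean`
(`--supports stmt-CriticalPhenomena-1368`).

**Radó extension at the disc.** For a chordal, Radó-continuous family `P`, the transport identity
`P (Φ D₀) = Φ_* P D₀` for two-marked unit discs `D₀` and maps `Φ` analytic and injective on an open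
neighbourhood of the CLOSED disc extends to every `Φ : C(ℂ, ℂ)` that is complex differentiable on
the open disc and injective on the closed disc. Proof: the approximants `Φₙ = Φ (rₙ ·)`,
`rₙ = 1 - 1/(n+2) ↑ 1`, are complex differentiable and injective on the open disc of radius `1/rₙ`,
which contains the closed unit disc, and `Φₙ → Φ` uniformly on the closed unit disc (uniform
continuity of `Φ` on the compact disc). With `Dₙ = Φₙ (D₀)` (`MarkedDomain.image`) the hypothesis
gives `P Dₙ = (Φₙ)_* P D₀`; dominated convergence on the compact traces (`P D₀`-a.e. curve lies in
the closed disc by chordality, `CurveClass.tendsto_map_of_tendstoUniformlyOn`) gives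
`(Φₙ)_* P D₀ ⇀ Φ_* P D₀`, while Radó continuity gives `P Dₙ ⇀ P D'`; weak limits of finite Borel
laws on the metric space `CurveClass ℂ` are unique
(`MeasureTheory.ext_of_forall_integral_eq_of_IsFiniteMeasure`).

References: P. Billingsley, *Convergence of Probability Measures* (2nd ed., 1999), Thm. 1.2
(bounded continuous test functions determine a finite Borel law on a metric space);
Ch. Pommerenke, *Boundary Behaviour of Conformal Maps* (1992), §2.3 (Radó's theorem, the name).
-/

noncomputable section

namespace Summit.CriticalPhenomena.SAWScalingLimit.Cruxes.Rigidity.Dichotomy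

open MeasureTheory Set Filter Topology Metric
open Literature.Probability.RandomPlanarGeometry
open scoped BoundedContinuousFunction

/-- **Push-forwards along uniformly convergent maps converge weakly.** If `μ` is a finite law on
curve classes almost every one of which has its trace in `K`, and `Φₙ → Φ` uniformly on `K`, then
`(Φₙ)_* μ ⇀ Φ_* μ`: `∫ f d((Φₙ)_* μ) = ∫ f (Φₙ ∘ γ) dμ → ∫ f (Φ ∘ γ) dμ` by dominated convergence
(`|f| ≤ ‖f‖`, and `Φₙ ∘ γ → Φ ∘ γ` in curve space for `γ ⊆ K`,
`CurveClass.tendsto_map_of_tendstoUniformlyOn`); the mechanism of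
`IsConformallyCovariant.isRadoContinuous`. [folklore] -/
private theorem tendsto_integral_map_of_tendstoUniformlyOn {μ : Measure (CurveClass ℂ)}
    [IsFiniteMeasure μ] {K : Set ℂ} (hK : ∀ᵐ γ ∂μ, CurveClass.range γ ⊆ K) {Φ : C(ℂ, ℂ)}
    {Φn : ℕ → C(ℂ, ℂ)} (hunif : TendstoUniformlyOn (fun n ↦ ⇑(Φn n)) Φ atTop K)
    (f : CurveClass ℂ →ᵇ ℝ) :
    Tendsto (fun n ↦ ∫ γ, f γ ∂(μ.map (CurveClass.map (Φn n)))) atTop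
      (𝓝 (∫ γ, f γ ∂(μ.map (CurveClass.map Φ)))) := by
  have hint : ∀ Ψ : C(ℂ, ℂ),
      ∫ γ, f γ ∂(μ.map (CurveClass.map Ψ)) = ∫ γ, f (CurveClass.map Ψ γ) ∂μ := fun Ψ ↦
    integral_map (CurveClass.measurable_map Ψ).aemeasurable f.continuous.aestronglyMeasurable
  simp_rw [hint]
  refine tendsto_integral_of_dominated_convergence (fun _ ↦ ‖f‖)
    (fun n ↦ (f.continuous.comp (CurveClass.continuous_map _)).aestronglyMeasurable)
    (integrable_const _) (fun n ↦ Eventually.of_forall fun γ ↦ f.norm_coe_le_norm _) ?_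
  filter_upwards [hK] with γ hγ
  exact (f.continuous.tendsto _).comp (CurveClass.tendsto_map_of_tendstoUniformlyOn hunif γ hγ)

/-- **Analytic approximants on the closed unit disc.** A continuous plane map `Φ` that is complex
differentiable on the open unit disc and injective on the closed unit disc is the uniform limit on
the closed unit disc of maps `Φₙ = Φ (rₙ ·)` (`rₙ = 1 - 1/(n+2)`), each complex differentiable and
injective on the open disc `Uₙ` of radius `1/rₙ > 1` (chain rule; `z ↦ rₙ z` maps `Uₙ` injectively
into the open unit disc), and `‖Φ (rₙ z) - Φ z‖` is uniformly small for `‖z‖ ≤ 1` because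
`‖rₙ z - z‖ ≤ 1 - rₙ → 0` and `Φ` is uniformly continuous on the compact closed disc. [folklore] -/
private theorem exists_approx_closedBall (Φ : C(ℂ, ℂ))
    (hΦd : DifferentiableOn ℂ Φ (ball (0 : ℂ) 1)) (hΦi : InjOn Φ (closedBall (0 : ℂ) 1)) :
    ∃ (Φn : ℕ → C(ℂ, ℂ)) (U : ℕ → Set ℂ), (∀ n, IsOpen (U n)) ∧
      (∀ n, closedBall (0 : ℂ) 1 ⊆ U n) ∧ (∀ n, DifferentiableOn ℂ (Φn n) (U n)) ∧
      (∀ n, InjOn (Φn n) (U n)) ∧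
      TendstoUniformlyOn (fun n ↦ ⇑(Φn n)) Φ atTop (closedBall (0 : ℂ) 1) := by
  -- the radii `rₙ = 1 - 1/(n+2) ∈ (0, 1)`, `1 - rₙ → 0`
  set r : ℕ → ℝ := fun n ↦ 1 - 1 / ((n : ℝ) + 2) with hr
  have hr0 : ∀ n, 0 < r n := fun n ↦ by
    have h2 : (0 : ℝ) < (n : ℝ) + 2 := by positivity
    have h3 : 1 / ((n : ℝ) + 2) < 1 := by
      rw [div_lt_one h2]
      linarith
    simp only [hr]
    linarith
  have hr1 : ∀ n, r n < 1 := fun n ↦ by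
    have h3 : (0 : ℝ) < 1 / ((n : ℝ) + 2) := by positivity
    simp only [hr]
    linarith
  have hr_tend : Tendsto (fun n ↦ 1 - r n) atTop (𝓝 0) := by
    have h : Tendsto (fun n : ℕ ↦ 1 / ((n : ℝ) + 2)) atTop (𝓝 0) :=
      tendsto_const_nhds.div_atTop
        (tendsto_atTop_add_const_right _ _ tendsto_natCast_atTop_atTop)
    refine h.congr fun n ↦ ?_
    simp only [hr]
    ring
  -- the scalings `z ↦ rₙ z`
  set S : ℕ → C(ℂ, ℂ) := fun n ↦ ⟨fun z ↦ (r n : ℂ) * z, by fun_prop⟩ with hS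
  have hS_apply : ∀ n z, S n z = (r n : ℂ) * z := fun n z ↦ rfl
  have hSmaps : ∀ n, MapsTo (S n) (ball (0 : ℂ) (1 / r n)) (ball (0 : ℂ) 1) := fun n z hz ↦ by
    rw [mem_ball_zero_iff] at hz ⊢
    rw [hS_apply, norm_mul, Complex.norm_of_nonneg (hr0 n).le]
    calc r n * ‖z‖ < r n * (1 / r n) := mul_lt_mul_of_pos_left hz (hr0 n)
      _ = 1 := mul_one_div_cancel (hr0 n).ne'
  have hSd : ∀ n, DifferentiableOn ℂ (S n) (ball (0 : ℂ) (1 / r n)) := fun n ↦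
    Differentiable.differentiableOn (by simp only [funext (hS_apply n)]; fun_prop)
  have hSi : ∀ n, InjOn (S n) (ball (0 : ℂ) (1 / r n)) := fun n ↦ by
    refine Function.Injective.injOn ?_
    simp only [funext (hS_apply n)]
    exact mul_right_injective₀ (Complex.ofReal_ne_zero.2 (hr0 n).ne')
  refine ⟨fun n ↦ Φ.comp (S n), fun n ↦ ball (0 : ℂ) (1 / r n), fun n ↦ isOpen_ball,
    fun n ↦ closedBall_subset_ball (one_lt_one_div (hr0 n) (hr1 n)),
    fun n ↦ (hΦd.comp (hSd n) (hSmaps n) :), fun n ↦ ?_, ?_⟩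
  · exact (hΦi.mono ball_subset_closedBall).comp (hSi n) (hSmaps n)
  · -- uniform convergence on the closed unit disc
    rw [Metric.tendstoUniformlyOn_iff]
    intro ε hε
    obtain ⟨δ, hδ, hδε⟩ := Metric.uniformContinuousOn_iff.1
      ((isCompact_closedBall (0 : ℂ) 1).uniformContinuousOn_of_continuous
        Φ.continuous.continuousOn) ε hε
    filter_upwards [hr_tend.eventually (eventually_lt_nhds hδ)] with n hn x hx
    have hx' : ‖x‖ ≤ 1 := mem_closedBall_zero_iff.1 hx
    rw [ContinuousMap.comp_apply, hS_apply]
    refine hδε x hx ((r n : ℂ) * x) ?_ ?_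
    · rw [mem_closedBall_zero_iff, norm_mul, Complex.norm_of_nonneg (hr0 n).le]
      calc r n * ‖x‖ ≤ 1 * 1 := mul_le_mul (hr1 n).le hx' (norm_nonneg _) zero_le_one
        _ = 1 := one_mul 1
    · rw [dist_eq_norm]
      have hxe : x - (r n : ℂ) * x = ((1 - r n : ℝ) : ℂ) * x := by
        push_cast
        ring
      rw [hxe, norm_mul, Complex.norm_of_nonneg (sub_nonneg.2 (hr1 n).le)]
      calc (1 - r n) * ‖x‖ ≤ (1 - r n) * 1 :=
            mul_le_mul_of_nonneg_left hx' (sub_nonneg.2 (hr1 n).le)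
        _ < δ := by rw [mul_one]; exact hn

/-- stub B2 (bookkeeping, Radó extension at the disc): for a chordal, Radó-continuous family, the transport identity `P (Φ D₀) = Φ_* P D₀` for maps analytic and injective near the CLOSED unit disc extends to every `Φ : C(ℂ, ℂ)` complex differentiable on the open disc and injective on the closed disc (approximate by `Φ (rₙ ·)`, `rₙ ↑ 1`: analytic near the closed disc, uniformly convergent on it; the image laws converge to `Φ_* P D₀` by dominated convergence on the compact traces and to `P D'` by Radó continuity; weak limits of finite Borel laws on the metric space `CurveClass ℂ` are unique). [folklore] -/
theorem stub_radoExtensionDisc : ∀ P : Literature.Probability.RandomPlanarGeometry.ChordalFamily, P.IsChordal → P.IsRadoContinuous → (∀ (D₀ D' : Literature.Probability.RandomPlanarGeometry.DobrushinDomain) (Φ : C(ℂ, ℂ)) (U : Set ℂ), D₀.carrier = Metric.ball 0 1 → IsOpen U → closure D₀.carrier ⊆ U → DifferentiableOn ℂ Φ U → Set.InjOn Φ U → D'.carrier = Φ '' D₀.carrier → D'.pt 0 = Φ (D₀.pt 0) → D'.pt 1 = Φ (D₀.pt 1) → P D' = (P D₀).map (Literature.Probability.RandomPlanarGeometry.CurveClass.map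 Φ)) → ∀ (D₀ D' : Literature.Probability.RandomPlanarGeometry.DobrushinDomain) (Φ : C(ℂ, ℂ)), D₀.carrier = Metric.ball 0 1 → DifferentiableOn ℂ Φ D₀.carrier → Set.InjOn Φ (closure D₀.carrier) → D'.carrier = Φ '' D₀.carrier → D'.pt 0 = Φ (D₀.pt 0) → D'.pt 1 = Φ (D₀.pt 1) → P D' = (P D₀).map (Literature.Probability.RandomPlanarGeometry.CurveClass.map Φ) := by
  intro P hch hRado hana D₀ D' Φ hball hΦd hΦi hD' h0 h1
  have hcl : closure D₀.carrier = closedBall (0 : ℂ) 1 := by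
    rw [hball, closure_ball (0 : ℂ) one_ne_zero]
  obtain ⟨Φn, U, hUo, hUsub, hd, hi, hunif⟩ := exists_approx_closedBall Φ
    (by simpa only [hball] using hΦd) (by simpa only [hcl] using hΦi)
  rw [← hcl] at hUsub hunif
  have hic : ∀ n, InjOn (Φn n) (closure D₀.carrier) := fun n ↦ (hi n).mono (hUsub n)
  have hdc : ∀ n, DifferentiableOn ℂ (Φn n) D₀.carrier := fun n ↦
    (hd n).mono (subset_closure.trans (hUsub n))
  -- the laws of the image domains `Φₙ D₀` are the push-forwards (hypothesis: `Φₙ` is analytic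
  -- and injective on the open neighbourhood `Uₙ` of the closed disc)
  have hDn : ∀ n, P (D₀.image (Φn n) (Φn n).continuous.continuousOn (hic n)) =
      (P D₀).map (CurveClass.map (Φn n)) := fun n ↦
    hana D₀ _ (Φn n) (U n) hball (hUo n) (hUsub n) (hd n) (hi n) rfl rfl rfl
  haveI := (hch D').1
  haveI := (hch D₀).1
  haveI : IsProbabilityMeasure ((P D₀).map (CurveClass.map Φ)) :=
    Measure.isProbabilityMeasure_map (CurveClass.measurable_map Φ).aemeasurable
  refine ext_of_forall_integral_eq_of_IsFiniteMeasure fun f ↦ ?_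
  -- Radó continuity: `P (Φₙ D₀) ⇀ P D'`
  have hlim := hRado D₀ D' (fun n ↦ D₀.image (Φn n) (Φn n).continuous.continuousOn (hic n)) Φ Φn
    hunif hΦd hΦi (fun n ↦ ⟨hdc n, hic n⟩) hD' h0 h1 (fun _ ↦ ⟨rfl, rfl, rfl⟩) f
  simp only [hDn] at hlim
  -- dominated convergence: `(Φₙ)_* P D₀ ⇀ Φ_* P D₀`; limits are unique
  exact tendsto_nhds_unique hlim
    (tendsto_integral_map_of_tendstoUniformlyOn ((hch D₀).2.mono fun _ h ↦ h.2.2) hunif f)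

end Summit.CriticalPhenomena.SAWScalingLimit.Cruxes.Rigidity.Dichotomy

end
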